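import Summits.QuantumFields.BalabanUV.T4Continuum.Support.OutputRateComplexSlice
import Summits.QuantumFields.BalabanUV.T4Continuum.Support.B13OpDatumJunctions

/-!
# OutputRateComplexSliceEntrywise — the two-constants junction IN THE W1 CURRENCY OF RECORD: entry by entry against the format
# weights (`B13OpDatum.InFormat` ∕ `B13OpDatumJunctions.WeightedEntrywiseRate`), the weight passing through the interpolation
# UNCHANGED because the one-run format bound and the two-run entry rate carry the SAME weight (ruling R51 (2))

Cell `pub-balaban`, unit `b2b-balaban-t4-ne5-p1` (row NE5 OWNER, gen 36; owner item «g36-c», ruling R51 (2), `HOME/CLAIMS.log` l.18137).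
Summits-side NEW WORK under the LEAN PLACEMENT RULE ([folklore] composition over ABSTRACT charts and entry sets; nothing printed is asserted;
no `[cite:]`; no `Prop`-valued fact minted; 0 `def`).  HONEST FRAMING: rung (B)+1 of the FINITE-VOLUME T⁴ continuum programme — NOT infinite
volume, NOT a mass gap, NOT the Clay problem, NOT a proof of NE5 (NOT PRINTED; GAPS G-t4-U3-1), NOT a proof of NE2 or NE3.  HONEST DEPENDENCY
(cell, verbatim): continuum YM on T⁴ ⇐ BetaPertH ∧ nine spine estimates (0/9 proved); BetaPertH ⇐ (D1) ∧ (D4) ∧ CAP+tail; G-an2-4 gates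
asym, D1 and NE2/3/4.

WHY.  The W1 binder OF RECORD is stated in ENTRY currency: `WeightedEntrywiseRate Fk rawA rawB W c rate` (`B13OpDatumJunctions`, p. «at step
`k` every raw entry of the two runs differs by at most `c·rate k·wt e`») — produced on REAL backgrounds by `B13ReadingsRecord` ∕
`B13ReadingsAssembly` from row NE3's `NE3Shape` + readings — while the one-run bounds are `InFormat (Fk k) K R` (`‖K e‖ ≤ R·wt e`; printed KIND:
[Balaban1988RG2Cluster] (1.7) p. 3, (2.16) p. 16, (1.43) p. 11).  BOTH carry the SAME weight `(Fk k).wt e`.  Substrate-p1's probe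
(`HOME/CLAIMS.log` l.18087) runs the two-constants junction `OutputRateComplexSlice.operatorRate_complex_of_realSlice_each` (p225933) ENTRY BY
ENTRY (`Op := ℂ`); ruling R51 (2) made the condition of record explicit: the real-slice rate clause and the closed-disc bound clause must be
in the same per-entry currency.  In the currency of record they ARE, and then the weight passes through the interpolation unchanged
(`w^{1−λ}·w^{λ} = w`): this module states the junction once in that currency, so that on Road D the W1 binder of record at COMPLEX chart
points follows from (i) the `WeightedEntrywiseRate` on the real window, (ii) per entry, holomorphy along the slices, (iii) the one-run
FORMAT bounds `InFormat (Fk k) · B` along the slices (printed KIND, uniform on the complex domain: [II] p. 6) — with the level-free pair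
`(c₁, rate) = (δ^{1−λ}(2B)^{λ}, k ↦ (θ^{1−λ})^k)`, `λ = (2∕π)·arctan(2r∕(1−r²))`, and NO degradation of the weights.

WHAT ([folklore]; 0 def; the loss exponent written INLINE as in p225933).
* `entryRate_complex_of_realSlice` (one level, one window; generic entry set `E`, format `F`): p225933 `_each` at `Op := ℂ`, `rOp := wt e`, per entry;
  `entryRate_complex_of_realSlice_diff`: the five-clause DIFFERENCE form (p225933 `operatorRate_complex_of_realSlice` per entry).
* `inFormat_of_slice` : the one-run format bound AT the chart point is a by-product of the per-entry slice letters (`γ z₀ = u`, `‖z₀‖ ≤ r ≤ 1`).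
* `weightedEntrywiseRate_complex_of_realSlice` (all levels; two charts as in R51 (4): recursion chart `𝒰` READ into the slice chart `𝒱` by
  `emb`, readings `hA`∕`hB`) ⟹ `WeightedEntrywiseRate F rawA rawB W (δ^{1−λ}(2B)^{λ}) (k ↦ (θ^{1−λ})^k)` over `Bg := 𝒰`, + `rawBounded_of_slice`.
* `entryRate_real_of_weightedEntrywiseRate` : the adapter reading hypothesis (i) from a `WeightedEntrywiseRate` over a REAL background type
  `BgR` through `ρ : BgR → 𝒱` (`real := Set.range ρ`); `weightedEntrywiseRate_complex_of_record` (§1–§3 together).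
* `hop_of_weightedEntrywiseRate_floor` : entry currency ⟹ the per-point END's `hop` (`Op := OpDatum E`, margin floor `r₀`), by
  `B13OpDatumJunctions.norm_opOf_sub_le`.
Instance of record (not built here): `E := Species T κ ι Ω 𝒴`, `KA g k v := (rsA g k v).kernel` (the species kernels of `B13Readings`),
`emb` ∕ `ρ` ∕ the slices = substrate O1 ∕ L-E12 objects.  0 sorry; axioms ⊆ {propext, Classical.choice, Quot.sound}.
-/

noncomputable section

open Complex Set Metric Real

namespace Summit.QuantumFields.BalabanUV.T4Continuum.OutputRateComplexSliceEntrywise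

open Summit.QuantumFields.BalabanUV.T4Continuum.B13OpDatum
open Summit.QuantumFields.BalabanUV.T4Continuum.B13OpDatumJunctions
open Summit.QuantumFields.BalabanUV.T4Continuum.OutputRateComplexSlice

variable {E : Type*} {𝒰 𝒱 : Type}

/-! ## §1 One level: the junction entry by entry against a format -/

/-- [folklore] **THE TWO-CONSTANTS JUNCTION, ENTRY BY ENTRY, IN FORMAT CURRENCY (one level `k`, one window `W`).**  Entry families
`KA KB : (ℕ → ℝ) → ℕ → 𝒱 → E → ℂ` on a slice chart `𝒱`, a format `F` on `E`; (i) the weighted entry rate `δ·θ^k·wt e` at every point of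
`real`; (ii) through every `u ∈ dom`, FOR EVERY ENTRY `e` a slice of relative depth `≤ r` with real diameter in `real` (the slice may depend on the entry —
the substrate's landed `∃`-per-entry packages inhabit this; one common slice is the special case) along which that entry of both families is
holomorphic in the open unit disc and continuous on the closed disc and obeys the one-run FORMAT bound `‖K (γ z) e‖ ≤ B·wt e`;
`0 ≤ δ ≤ 2B`, `0 ≤ θ ≤ 1`, `r < 1` ⟹ at every `u ∈ dom` the weighted entry rate with the level-free pair `(δ^{1−λ}(2B)^{λ}, θ^{1−λ})` and the
SAME weight `wt e`. -/
theorem entryRate_complex_of_realSlice (F : Format E) {KA KB : (ℕ → ℝ) → ℕ → 𝒱 → E → ℂ} {W : Set (ℕ → ℝ)} {real dom : Set 𝒱}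
    {δ θ B r : ℝ} {k : ℕ} (hδ : 0 ≤ δ) (hδB : δ ≤ 2 * B) (hθ : 0 ≤ θ) (hθ1 : θ ≤ 1) (hr : r < 1)
    (hreal : ∀ g ∈ W, ∀ v ∈ real, ∀ e, ‖KA g k v e - KB g k v e‖ ≤ δ * θ ^ k * F.wt e)
    (hslice : ∀ g ∈ W, ∀ u ∈ dom, ∀ e, ∃ γ : ℂ → 𝒱, ∃ z₀ : ℂ, ‖z₀‖ ≤ r ∧ γ z₀ = u ∧ (∀ x : ℝ, |x| < 1 → γ x ∈ real) ∧
      DiffContOnCl ℂ (fun z => KA g k (γ z) e) (ball 0 1) ∧ DiffContOnCl ℂ (fun z => KB g k (γ z) e) (ball 0 1) ∧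
        (∀ z : ℂ, ‖z‖ ≤ 1 → ‖KA g k (γ z) e‖ ≤ B * F.wt e) ∧ ∀ z : ℂ, ‖z‖ ≤ 1 → ‖KB g k (γ z) e‖ ≤ B * F.wt e) :
    ∀ g ∈ W, ∀ u ∈ dom, ∀ e,
      ‖KA g k u e - KB g k u e‖ ≤ (δ ^ (1 - 2 / π * Real.arctan (2 * r / (1 - r ^ 2))) *
        (2 * B) ^ (2 / π * Real.arctan (2 * r / (1 - r ^ 2)))) *
          (θ ^ (1 - 2 / π * Real.arctan (2 * r / (1 - r ^ 2)))) ^ k * F.wt e := by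
  intro g hg u hu e
  -- p225933 `_each` at `Op := ℂ`, `opA g k v := KA g k v e`, `rOp := fun _ => wt e`, on the window `{g}`, with THIS entry's slice
  have key := operatorRate_complex_of_realSlice_each (𝒰 := 𝒱) (Op := ℂ) (opA := fun g' k' v => KA g' k' v e)
    (opB := fun g' k' v => KB g' k' v e) (W := {g}) (real := real) (dom := dom) (rOp := fun _ => F.wt e) (k := k)
    hδ hδB hθ hθ1 (F.wt_pos e).le hr (fun g' hg' v hv => by
      rw [Set.mem_singleton_iff.mp hg']; exact hreal g hg v hv e)
    (fun g' hg' u' hu' => by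
      rw [Set.mem_singleton_iff.mp hg']
      exact hslice g hg u' hu' e)
  exact key g (Set.mem_singleton g) u hu

/-- [folklore] **The same in the five-clause DIFFERENCE form** (ONE slice per point along which the DIFFERENCE of the two entry families is
holomorphic, continuous on the closed disc and bounded there by `2B·wt e` per entry — p225933's `operatorRate_complex_of_realSlice` at
`Op := ℂ` per entry; the form to use when the two runs are read along a common slice and only the difference is controlled). -/
theorem entryRate_complex_of_realSlice_diff (F : Format E) {KA KB : (ℕ → ℝ) → ℕ → 𝒱 → E → ℂ} {W : Set (ℕ → ℝ)} {real dom : Set 𝒱}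
    {δ θ B r : ℝ} {k : ℕ} (hδ : 0 ≤ δ) (hδB : δ ≤ 2 * B) (hθ : 0 ≤ θ) (hθ1 : θ ≤ 1) (hr : r < 1)
    (hreal : ∀ g ∈ W, ∀ v ∈ real, ∀ e, ‖KA g k v e - KB g k v e‖ ≤ δ * θ ^ k * F.wt e)
    (hslice : ∀ g ∈ W, ∀ u ∈ dom, ∀ e, ∃ γ : ℂ → 𝒱, ∃ z₀ : ℂ, ‖z₀‖ ≤ r ∧ γ z₀ = u ∧ (∀ x : ℝ, |x| < 1 → γ x ∈ real) ∧
      DiffContOnCl ℂ (fun z => KA g k (γ z) e - KB g k (γ z) e) (ball 0 1) ∧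
        ∀ z : ℂ, ‖z‖ ≤ 1 → ‖KA g k (γ z) e - KB g k (γ z) e‖ ≤ 2 * B * F.wt e) :
    ∀ g ∈ W, ∀ u ∈ dom, ∀ e,
      ‖KA g k u e - KB g k u e‖ ≤ (δ ^ (1 - 2 / π * Real.arctan (2 * r / (1 - r ^ 2))) *
        (2 * B) ^ (2 / π * Real.arctan (2 * r / (1 - r ^ 2)))) *
          (θ ^ (1 - 2 / π * Real.arctan (2 * r / (1 - r ^ 2)))) ^ k * F.wt e := by
  intro g hg u hu e
  have key := operatorRate_complex_of_realSlice (𝒰 := 𝒱) (Op := ℂ) (opA := fun g' k' v => KA g' k' v e)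
    (opB := fun g' k' v => KB g' k' v e) (W := {g}) (real := real) (dom := dom) (rOp := fun _ => F.wt e) (k := k)
    hδ hδB hθ hθ1 (F.wt_pos e).le hr (fun g' hg' v hv => by
      rw [Set.mem_singleton_iff.mp hg']; exact hreal g hg v hv e)
    (fun g' hg' u' hu' => by
      rw [Set.mem_singleton_iff.mp hg']
      exact hslice g hg u' hu' e)
  exact key g (Set.mem_singleton g) u hu

/-- [folklore] **THE ONE-RUN FORMAT BOUND AT THE CHART POINT IS A BY-PRODUCT OF THE SLICE LETTERS**: the slice passes through `u = γ z₀`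
with `‖z₀‖ ≤ r ≤ 1`, where the format bound along the closed disc applies. -/
theorem inFormat_of_slice (F : Format E) {K : 𝒱 → E → ℂ} {u : 𝒱} {B r : ℝ} (hr : r ≤ 1)
    (h : ∀ e, ∃ γ : ℂ → 𝒱, ∃ z₀ : ℂ, ‖z₀‖ ≤ r ∧ γ z₀ = u ∧ ∀ z : ℂ, ‖z‖ ≤ 1 → ‖K (γ z) e‖ ≤ B * F.wt e) :
    InFormat F (K u) B := by
  intro e
  obtain ⟨γ, z₀, hz₀, hγu, hbd⟩ := h e
  rw [← hγu]
  exact hbd z₀ (hz₀.trans hr)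

/-! ## §2 All levels, two charts: the W1 binder of record over the recursion chart -/

/-- [folklore] **`WeightedEntrywiseRate` OVER THE RECURSION CHART FROM THE REAL WINDOW + SLICE LETTERS** (two charts, R51 (4)).  Raw
suppliers `rawA rawB : (ℕ → ℝ) → 𝒰 → ℕ → E → ℂ` over a recursion chart `𝒰` (the `Bg` slot of `WeightedEntrywiseRate`) that READ entry
families `KA KB` on a slice chart `𝒱` through `emb : 𝒰 → 𝒱` (`hA`∕`hB`); formats `F : ℕ → Format E`; at every level the weighted entry rate
`δ·θ^k·wt` on `real ⊆ 𝒱` and the PER-ENTRY slice letters (one slice per `(k, g, u, e)`) with the one-run format bounds `‖K (γ z) e‖ ≤ B·wt e` ⟹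
`WeightedEntrywiseRate F rawA rawB W (δ^{1−λ}(2B)^{λ}) (k ↦ (θ^{1−λ})^k)` — the W1 binder of record (`hwer` of
`B13StepEndInsOp.ne5_of_record_insOp` with `Bg := 𝒰`) at the level-free degraded pair, weights unchanged. -/
theorem weightedEntrywiseRate_complex_of_realSlice (F : ℕ → Format E) {rawA rawB : (ℕ → ℝ) → 𝒰 → ℕ → E → ℂ}
    {KA KB : (ℕ → ℝ) → ℕ → 𝒱 → E → ℂ} (emb : 𝒰 → 𝒱) {W : Set (ℕ → ℝ)} {real : Set 𝒱} {δ θ B r : ℝ}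
    (hδ : 0 ≤ δ) (hδB : δ ≤ 2 * B) (hθ : 0 ≤ θ) (hθ1 : θ ≤ 1) (hr : r < 1)
    (hA : ∀ g ∈ W, ∀ u k, rawA g u k = KA g k (emb u)) (hB : ∀ g ∈ W, ∀ u k, rawB g u k = KB g k (emb u))
    (hreal : ∀ k, ∀ g ∈ W, ∀ v ∈ real, ∀ e, ‖KA g k v e - KB g k v e‖ ≤ δ * θ ^ k * (F k).wt e)
    (hslice : ∀ k, ∀ g ∈ W, ∀ (u : 𝒰) (e : E), ∃ γ : ℂ → 𝒱, ∃ z₀ : ℂ, ‖z₀‖ ≤ r ∧ γ z₀ = emb u ∧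
      (∀ x : ℝ, |x| < 1 → γ x ∈ real) ∧
      DiffContOnCl ℂ (fun z => KA g k (γ z) e) (ball 0 1) ∧ DiffContOnCl ℂ (fun z => KB g k (γ z) e) (ball 0 1) ∧
        (∀ z : ℂ, ‖z‖ ≤ 1 → ‖KA g k (γ z) e‖ ≤ B * (F k).wt e) ∧ ∀ z : ℂ, ‖z‖ ≤ 1 → ‖KB g k (γ z) e‖ ≤ B * (F k).wt e) :
    WeightedEntrywiseRate F rawA rawB W
      (δ ^ (1 - 2 / π * Real.arctan (2 * r / (1 - r ^ 2))) * (2 * B) ^ (2 / π * Real.arctan (2 * r / (1 - r ^ 2))))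
      (fun k => (θ ^ (1 - 2 / π * Real.arctan (2 * r / (1 - r ^ 2)))) ^ k) := by
  intro k g hg u e
  rw [hA g hg u k, hB g hg u k]
  exact entryRate_complex_of_realSlice (F k) (dom := Set.range emb) hδ hδB hθ hθ1 hr (hreal k)
    (fun g' hg' v hv e' => by
      obtain ⟨u', rfl⟩ := hv
      exact hslice k g' hg' u' e') g hg (emb u) (Set.mem_range_self u) e

/-- [folklore] **`RawBounded` OF BOTH RUNS OVER THE RECURSION CHART from the same slice letters** (format bound `B` at every read point). -/
theorem rawBounded_of_slice (F : ℕ → Format E) {rawA rawB : (ℕ → ℝ) → 𝒰 → ℕ → E → ℂ}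
    {KA KB : (ℕ → ℝ) → ℕ → 𝒱 → E → ℂ} (emb : 𝒰 → 𝒱) {W : Set (ℕ → ℝ)} {real : Set 𝒱} {B r : ℝ} (hr : r ≤ 1)
    (hA : ∀ g ∈ W, ∀ u k, rawA g u k = KA g k (emb u)) (hB : ∀ g ∈ W, ∀ u k, rawB g u k = KB g k (emb u))
    (hslice : ∀ k, ∀ g ∈ W, ∀ (u : 𝒰) (e : E), ∃ γ : ℂ → 𝒱, ∃ z₀ : ℂ, ‖z₀‖ ≤ r ∧ γ z₀ = emb u ∧
      (∀ x : ℝ, |x| < 1 → γ x ∈ real) ∧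
      DiffContOnCl ℂ (fun z => KA g k (γ z) e) (ball 0 1) ∧ DiffContOnCl ℂ (fun z => KB g k (γ z) e) (ball 0 1) ∧
        (∀ z : ℂ, ‖z‖ ≤ 1 → ‖KA g k (γ z) e‖ ≤ B * (F k).wt e) ∧ ∀ z : ℂ, ‖z‖ ≤ 1 → ‖KB g k (γ z) e‖ ≤ B * (F k).wt e) :
    RawBounded F rawA W ∧ RawBounded F rawB W := by
  constructor
  · intro k g hg u
    rw [hA g hg u k]
    refine (inFormat_of_slice (F k) (B := B) hr fun e => ?_).formatBounded
    obtain ⟨γ, z₀, hz₀, hγu, -, -, -, hbdA, -⟩ := hslice k g hg u e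
    exact ⟨γ, z₀, hz₀, hγu, hbdA⟩
  · intro k g hg u
    rw [hB g hg u k]
    refine (inFormat_of_slice (F k) (B := B) hr fun e => ?_).formatBounded
    obtain ⟨γ, z₀, hz₀, hγu, -, -, -, -, hbdB⟩ := hslice k g hg u e
    exact ⟨γ, z₀, hz₀, hγu, hbdB⟩

/-! ## §3 The adapter: hypothesis (i) from a `WeightedEntrywiseRate` over a real background type -/

/-- [folklore] **READING THE REAL-WINDOW RATE FROM A `WeightedEntrywiseRate` OVER REAL BACKGROUNDS.**  If the entry families are read on a
real background type `BgR` through `ρ : BgR → 𝒱` (`hAr`∕`hBr`) and the W1 binder of record holds there with constant `δ` and rate `θ^k`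
(what `B13ReadingsRecord.weightedEntrywiseRate_record_balaban_ne3Shape` delivers, `Bg := BgR`), then hypothesis (i) of §1∕§2 holds on
`real := Set.range ρ`.  (Whether `Set.range ρ` contains the real diameters of the slices is the instance's question Q-NE23-W.) -/
theorem entryRate_real_of_weightedEntrywiseRate (F : ℕ → Format E) {BgR : Type} {rawAr rawBr : (ℕ → ℝ) → BgR → ℕ → E → ℂ}
    {KA KB : (ℕ → ℝ) → ℕ → 𝒱 → E → ℂ} (ρ : BgR → 𝒱) {W : Set (ℕ → ℝ)} {δ θ : ℝ}
    (hAr : ∀ g ∈ W, ∀ b k, rawAr g b k = KA g k (ρ b)) (hBr : ∀ g ∈ W, ∀ b k, rawBr g b k = KB g k (ρ b))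
    (hwer : WeightedEntrywiseRate F rawAr rawBr W δ fun k => θ ^ k) :
    ∀ k, ∀ g ∈ W, ∀ v ∈ Set.range ρ, ∀ e, ‖KA g k v e - KB g k v e‖ ≤ δ * θ ^ k * (F k).wt e := by
  rintro k g hg v ⟨b, rfl⟩ e
  rw [← hAr g hg b k, ← hBr g hg b k]
  exact hwer k g hg b e

/-- [folklore] **END OF THIS MODULE (the three pieces together).**  From the W1 binder of record on REAL backgrounds (`hwer`, rate `θ^k`), the
readings `hAr`∕`hBr`∕`hA`∕`hB`, and the per-entry slice letters whose real diameters lie in `Set.range ρ`: the W1 binder of record over the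
recursion chart at the degraded level-free pair, and `RawBounded` of both runs there. -/
theorem weightedEntrywiseRate_complex_of_record (F : ℕ → Format E) {BgR : Type}
    {rawAr rawBr : (ℕ → ℝ) → BgR → ℕ → E → ℂ} {rawA rawB : (ℕ → ℝ) → 𝒰 → ℕ → E → ℂ}
    {KA KB : (ℕ → ℝ) → ℕ → 𝒱 → E → ℂ} (ρ : BgR → 𝒱) (emb : 𝒰 → 𝒱) {W : Set (ℕ → ℝ)} {δ θ B r : ℝ}
    (hδ : 0 ≤ δ) (hδB : δ ≤ 2 * B) (hθ : 0 ≤ θ) (hθ1 : θ ≤ 1) (hr : r < 1)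
    (hAr : ∀ g ∈ W, ∀ b k, rawAr g b k = KA g k (ρ b)) (hBr : ∀ g ∈ W, ∀ b k, rawBr g b k = KB g k (ρ b))
    (hA : ∀ g ∈ W, ∀ u k, rawA g u k = KA g k (emb u)) (hB : ∀ g ∈ W, ∀ u k, rawB g u k = KB g k (emb u))
    (hwer : WeightedEntrywiseRate F rawAr rawBr W δ fun k => θ ^ k)
    (hslice : ∀ k, ∀ g ∈ W, ∀ (u : 𝒰) (e : E), ∃ γ : ℂ → 𝒱, ∃ z₀ : ℂ, ‖z₀‖ ≤ r ∧ γ z₀ = emb u ∧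
      (∀ x : ℝ, |x| < 1 → γ x ∈ Set.range ρ) ∧
      DiffContOnCl ℂ (fun z => KA g k (γ z) e) (ball 0 1) ∧ DiffContOnCl ℂ (fun z => KB g k (γ z) e) (ball 0 1) ∧
        (∀ z : ℂ, ‖z‖ ≤ 1 → ‖KA g k (γ z) e‖ ≤ B * (F k).wt e) ∧ ∀ z : ℂ, ‖z‖ ≤ 1 → ‖KB g k (γ z) e‖ ≤ B * (F k).wt e) :
    WeightedEntrywiseRate F rawA rawB W
      (δ ^ (1 - 2 / π * Real.arctan (2 * r / (1 - r ^ 2))) * (2 * B) ^ (2 / π * Real.arctan (2 * r / (1 - r ^ 2))))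
      (fun k => (θ ^ (1 - 2 / π * Real.arctan (2 * r / (1 - r ^ 2)))) ^ k) ∧
      RawBounded F rawA W ∧ RawBounded F rawB W :=
  ⟨weightedEntrywiseRate_complex_of_realSlice F emb hδ hδB hθ hθ1 hr hA hB
    (entryRate_real_of_weightedEntrywiseRate F ρ hAr hBr hwer) hslice,
    rawBounded_of_slice F emb hr.le hA hB hslice⟩

/-! ## §4 … and on to the per-point END's `hop` (norm currency, margin floor) -/

/-- [folklore] **ENTRY CURRENCY ⇒ THE PER-POINT END's `hop`.**  If the per-point slots read the ASSEMBLED data `opOf F rawA g (pr w) k`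
(`Op := OpDatum E`, `pr` = the projection of the two-row chart onto the recursion chart, R49: operators row-blind), then a
`WeightedEntrywiseRate F rawA rawB W c rate` over the recursion chart (§2∕§3) with `RawBounded` suppliers and an [I]-type margin floor
`0 < r₀ ≤ rOp k` give the `hop` binder of `OutputRateFunctionalTablesComplexPointwise.ne5_of_pointwiseSlots_reIm` ∕
`OutputRateComplexSliceEnd` in the shape `‖opA − opB‖ ≤ (c∕r₀)·rate k·rOp k` (`B13OpDatumJunctions.norm_opOf_sub_le` BY NAME). -/
theorem hop_of_weightedEntrywiseRate_floor (F : ℕ → Format E) {rawA rawB : (ℕ → ℝ) → 𝒰 → ℕ → E → ℂ} {W : Set (ℕ → ℝ)}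
    {c r₀ : ℝ} {rate rOp : ℕ → ℝ} {ι' : Type*} (pr : ι' → 𝒰) (hRA : RawBounded F rawA W) (hRB : RawBounded F rawB W)
    (h : WeightedEntrywiseRate F rawA rawB W c rate) (hc : 0 ≤ c) (hrate : ∀ k, 0 ≤ rate k) (hfl : ∀ k, r₀ ≤ rOp k)
    (hr₀ : 0 < r₀) :
    ∀ k, ∀ g ∈ W, ∀ w : ι', ‖opOf F rawA g (pr w) k - opOf F rawB g (pr w) k‖ ≤ c / r₀ * rate k * rOp k := by
  intro k g hg w
  calc ‖opOf F rawA g (pr w) k - opOf F rawB g (pr w) k‖ ≤ c * rate k := norm_opOf_sub_le hRA hRB h hc hrate k hg (pr w)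
    _ = c / r₀ * rate k * r₀ := by field_simp
    _ ≤ c / r₀ * rate k * rOp k :=
      mul_le_mul_of_nonneg_left (hfl k) (mul_nonneg (div_nonneg hc hr₀.le) (hrate k))

end Summit.QuantumFields.BalabanUV.T4Continuum.OutputRateComplexSliceEntrywise

end
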